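import Summits.AnomalousDissipation.AnomalousDissipation.Theorems.SawtoothPulseCascadeApproxLipSlot
import Summits.AnomalousDissipation.AnomalousDissipation.Theorems.SawtoothPulseCascadeApproxPieces
import Literature.Analysis.FluidPDE.SawtoothCascadeK2Lipschitz

/-!
# The per-phase Lipschitz cap on the realigned pieces and the Lipschitz phase envelope
(route `AnomalousDissipation/SawtoothPulseCascade`; helper for the crux ApproxSol58 =
stmt-AnomalousDissipation-19688, S2 `stub_responseLipEnvelope` of the lead's reshaped line `linear-response-lip`)

The Lipschitz twin of `…ApproxPieces`.  The per-phase LIPSCHITZ cap (`K2LipschitzGrowthClassical P G`, Literature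
`SawtoothCascadeK2Lipschitz.lean`; here its body at a fixed admissible viscosity `ν` is the hypothesis `hLipν`) bounds
a classical homogeneous piece `W` started at `tInject j₀ hz` from a residual-comb datum `w₀` by
`‖D(W(t))(x)‖ ≤ G^{J+1−j₀} (D₁ + (N_{j₀}/δ_{j₀}) D₀)` on the phase-`J` window (`D₀ ≥ sup ‖w₀‖`, `D₁ ≥ sup ‖Dw₀‖`).
For the realigned comb pieces of the pipeline (`|g k| ≤ G₀ k`, `|(g k)'| ≤ G₁ k`) and the slot-wise Lipschitz bound
of `…ApproxLipSlot` this gives the LIPSCHITZ PHASE ENVELOPE: for `t` in slot `k < 2(J+1)` (`tStart (J+1) ≤ T'`),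

`‖∂ᵢ L(t)(x)‖ ≤ Σ_{l<k} G^{k/2+1−l/2} (G₁ l + (N_{l/2}/δ_{l/2}) G₀ l) + 24π√(2π) ν N_{k/2}² γ / δ_{k/2}²`.
-/

set_option linter.dupNamespace false

noncomputable section

namespace Summit.AnomalousDissipation.AnomalousDissipation.Theorems.SawtoothPulseCascade.ApproxResponse

open Set MeasureTheory
open scoped ContDiff InnerProductSpace
open Literature.Analysis Literature.Analysis.FunctionSpaces Literature.Analysis.FluidPDE
open Literature.Analysis.FluidPDE.SawtoothCascade
open Literature.Analysis.FluidPDE.SawtoothCascade.CascadeParams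
open Summit.AnomalousDissipation.AnomalousDissipation.Theorems.SawtoothPulseCascade.K2Classical

/-! ## §1 Comb profiles as Lipschitz data -/

/-- Datum sizes of a parallel comb field `x ↦ g(x_k) e_m`: `‖·‖ ≤ G₀` and `‖D·‖ ≤ G₁` from `|g| ≤ G₀`, `|g'| ≤ G₁`. -/
theorem comb_datum_sizes {g : ℝ → ℝ} (hg : ContDiff ℝ ∞ g) (hper : Function.Periodic g 1) {G₀ G₁ : ℝ}
    (hG₀ : ∀ y, |g y| ≤ G₀) (hG₁ : ∀ y, |deriv g y| ≤ G₁) (k m : Fin 2) :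
    (∀ x : UnitAddTorus (Fin 2), ‖g (Torus.repr x k) • EuclideanSpace.single m (1 : ℝ)‖ ≤ G₀) ∧
      (∀ x : UnitAddTorus (Fin 2),
        ‖Torus.fderiv (fun y : UnitAddTorus (Fin 2) => g (Torus.repr y k) • EuclideanSpace.single m (1 : ℝ)) x‖ ≤ G₁) :=
  ⟨fun x => by rw [norm_parallel_eq]; exact hG₀ _,
    fun x => (norm_fderiv_parallel_le (k := k) (m := m) hper hg x).trans (hG₁ _)⟩

/-! ## §2 The Lipschitz cap of one realigned piece -/

/-- **The Lipschitz cap bounds a realigned piece.**  Let the per-phase Lipschitz cap hold at viscosity `ν` with factor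
`G` (the body of `K2LipschitzGrowthClassical P G` at `ν`), and let `(W, R)` be a classical homogeneous linearised solution
on `[tInject j₀ hz, T']` with a residual-comb datum `w₀` of sizes `‖w₀‖ ≤ D₀`, `‖Dw₀‖ ≤ D₁`.  Then on every phase
`J ≥ j₀` with `tStart (J+1) ≤ T'`:  `‖D(W(t))(x)‖ ≤ G^{J+1−j₀} (D₁ + (N_{j₀}/δ_{j₀}) D₀)` for
`t ∈ [max (tInject j₀ hz) (tStart J), tStart (J+1)]`. -/
theorem piece_lip_bound (P : CascadeParams) {G ν T' D₀ D₁ : ℝ}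
    (hLipν : ∀ (j₀ J : ℕ), j₀ ≤ J → ∀ (hz : Bool)
      (w₀ : UnitAddTorus (Fin 2) → EuclideanSpace ℝ (Fin 2))
      (w : ℝ → UnitAddTorus (Fin 2) → EuclideanSpace ℝ (Fin 2)) (q : ℝ → UnitAddTorus (Fin 2) → ℝ),
      ShearCombDatum (P.N j₀) hz w₀ →
      Torus.IsSmoothSpaceTimeOn (Icc (CascadeParams.tInject j₀ hz) (CascadeParams.tStart (J + 1))) w →
      Torus.IsSmoothSpaceTimeOn (Icc (CascadeParams.tInject j₀ hz) (CascadeParams.tStart (J + 1))) q →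
      (∀ t ∈ Icc (CascadeParams.tInject j₀ hz) (CascadeParams.tStart (J + 1)), Torus.IsDivFree (w t)) →
      (∀ t ∈ Icc (CascadeParams.tInject j₀ hz) (CascadeParams.tStart (J + 1)), ∀ x,
        Torus.timeDerivWithin (Icc (CascadeParams.tInject j₀ hz) (CascadeParams.tStart (J + 1))) w t x +
          Torus.convect (P.field t) (w t) x + Torus.convect (w t) (P.field t) x =
          ν • Torus.laplacian (w t) x - Torus.gradient (q t) x) →
      w (CascadeParams.tInject j₀ hz) = w₀ →
      ∀ (D₀ D₁ : ℝ), (∀ x, ‖w₀ x‖ ≤ D₀) → (∀ x, ‖Torus.fderiv w₀ x‖ ≤ D₁) →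
      ∀ t ∈ Icc (max (CascadeParams.tInject j₀ hz) (CascadeParams.tStart J)) (CascadeParams.tStart (J + 1)), ∀ x,
        ‖Torus.fderiv (w t) x‖ ≤ G ^ (J + 1 - j₀) * (D₁ + (P.N j₀ : ℝ) / P.δ j₀ * D₀))
    {j₀ : ℕ} {hz : Bool} {w₀ : UnitAddTorus (Fin 2) → EuclideanSpace ℝ (Fin 2)}
    (hdat : ShearCombDatum (P.N j₀) hz w₀) (hD₀ : ∀ x, ‖w₀ x‖ ≤ D₀) (hD₁ : ∀ x, ‖Torus.fderiv w₀ x‖ ≤ D₁)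
    {W : ℝ → UnitAddTorus (Fin 2) → EuclideanSpace ℝ (Fin 2)} {R : ℝ → UnitAddTorus (Fin 2) → ℝ}
    (hW : Torus.IsSmoothSpaceTimeOn (Icc (CascadeParams.tInject j₀ hz) T') W)
    (hR : Torus.IsSmoothSpaceTimeOn (Icc (CascadeParams.tInject j₀ hz) T') R)
    (hWdiv : ∀ t ∈ Icc (CascadeParams.tInject j₀ hz) T', Torus.IsDivFree (W t))
    (hWlin : ∀ t ∈ Icc (CascadeParams.tInject j₀ hz) T', ∀ x,
      Torus.timeDerivWithin (Icc (CascadeParams.tInject j₀ hz) T') W t x +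
        Torus.convect (P.field t) (W t) x + Torus.convect (W t) (P.field t) x =
          ν • Torus.laplacian (W t) x - Torus.gradient (R t) x)
    (hW0 : W (CascadeParams.tInject j₀ hz) = w₀)
    {J : ℕ} (hJ : j₀ ≤ J) (hJT : CascadeParams.tStart (J + 1) ≤ T')
    {t : ℝ} (ht : t ∈ Icc (max (CascadeParams.tInject j₀ hz) (CascadeParams.tStart J)) (CascadeParams.tStart (J + 1)))
    (x : UnitAddTorus (Fin 2)) :
    ‖Torus.fderiv (W t) x‖ ≤ G ^ (J + 1 - j₀) * (D₁ + (P.N j₀ : ℝ) / P.δ j₀ * D₀) := by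
  have hlt : CascadeParams.tInject j₀ hz < CascadeParams.tStart (J + 1) :=
    (tInject_lt_tStart_succ j₀ hz).trans_le (tStart_strictMono.monotone (Nat.succ_le_succ hJ))
  have hsub : Icc (CascadeParams.tInject j₀ hz) (CascadeParams.tStart (J + 1)) ⊆ Icc (CascadeParams.tInject j₀ hz) T' :=
    Icc_subset_Icc le_rfl hJT
  have hlin' : ∀ s ∈ Icc (CascadeParams.tInject j₀ hz) (CascadeParams.tStart (J + 1)), ∀ x,
      Torus.timeDerivWithin (Icc (CascadeParams.tInject j₀ hz) (CascadeParams.tStart (J + 1))) W s x +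
        Torus.convect (P.field s) (W s) x + Torus.convect (W s) (P.field s) x =
          ν • Torus.laplacian (W s) x - Torus.gradient (R s) x := by
    intro s hs x
    rw [timeDerivWithin_Icc_eq_of_subset hlt hsub hW hs x]
    exact hWlin s (hsub hs) x
  exact hLipν j₀ J hJ hz w₀ W R hdat (hW.mono hsub) (hR.mono hsub) (fun s hs => hWdiv s (hsub hs)) hlin' hW0
    D₀ D₁ hD₀ hD₁ t ht x

/-! ## §3 The Lipschitz phase envelope -/

section Envelope

variable (P : CascadeParams) {ν T' : ℝ} {K : ℕ}
  {W : ℕ → ℝ → UnitAddTorus (Fin 2) → EuclideanSpace ℝ (Fin 2)} {g : ℕ → ℝ → ℝ} {G₀ G₁ : ℕ → ℝ}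

/-- The datum of piece `i` is a residual comb of frequency `N_{i/2}` of sizes `‖·‖ ≤ G₀ i`, `‖D·‖ ≤ G₁ i`. -/
theorem piece_lip_datum (hg : ∀ k < K, ContDiff ℝ ∞ (g k) ∧ Function.Periodic (g k) 1)
    (hcomb : ∀ k < K, ∀ m : ℤ, (¬ ∃ n : ℤ, m = (2 * n + 1) * (P.N (k / 2) : ℤ)) →
      fourierCoeff (AddCircle.liftIco 1 0 fun y => (g k y : ℂ)) m = 0)
    (hG₀ : ∀ k < K, ∀ y, |g k y| ≤ G₀ k) (hG₁ : ∀ k < K, ∀ y, |deriv (g k) y| ≤ G₁ k)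
    (hW0H : ∀ j, 2 * j < K → W (2 * j) (tStart j) =
      fun x => g (2 * j) (Torus.repr x 1) • EuclideanSpace.single (0 : Fin 2) (1 : ℝ))
    (hW0V : ∀ j, 2 * j + 1 < K → W (2 * j + 1) (tStart j + tHalf j) =
      fun x => g (2 * j + 1) (Torus.repr x 0) • EuclideanSpace.single (1 : Fin 2) (1 : ℝ))
    {i : ℕ} (hi : i < K) :
    ShearCombDatum (P.N (i / 2)) (i % 2 == 0) (W i (CascadeParams.tInject (i / 2) (i % 2 == 0))) ∧
      (∀ x, ‖W i (CascadeParams.tInject (i / 2) (i % 2 == 0)) x‖ ≤ G₀ i) ∧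
      (∀ x, ‖Torus.fderiv (W i (CascadeParams.tInject (i / 2) (i % 2 == 0))) x‖ ≤ G₁ i) := by
  obtain ⟨j, rfl | rfl⟩ := Nat.even_or_odd' i
  · rw [slotStart_even, show 2 * j / 2 = j by omega, show (2 * j % 2 == 0) = true by simp, hW0H j hi]
    obtain ⟨h0, h1⟩ := comb_datum_sizes (hg _ hi).1 (hg _ hi).2 (hG₀ _ hi) (hG₁ _ hi) 1 0
    exact ⟨shearCombDatum_of_comb_H (hg _ hi).1 (hg _ hi).2 (by simpa [show 2 * j / 2 = j by omega] using hcomb _ hi),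
      h0, h1⟩
  · rw [slotStart_odd, show (2 * j + 1) / 2 = j by omega, show ((2 * j + 1) % 2 == 0) = false by simp, hW0V j hi]
    obtain ⟨h0, h1⟩ := comb_datum_sizes (hg _ hi).1 (hg _ hi).2 (hG₀ _ hi) (hG₁ _ hi) 0 1
    exact ⟨shearCombDatum_of_comb_V (hg _ hi).1 (hg _ hi).2 (by simpa [show (2 * j + 1) / 2 = j by omega] using hcomb _ hi),
      h0, h1⟩

/-- **The Lipschitz phase envelope of the forced response.**  Let the per-phase Lipschitz cap hold at viscosity `ν`
with factor `G` (`hLipν`), let `(L, q)` be the forced response on `[0, T']` from zero, `tStart (J+1) ≤ T'`, and let the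
realigned comb profiles `g k` (`k < 2(J+1)`; sizes `|g k| ≤ G₀ k`, `|(g k)'| ≤ G₁ k`) and pieces `W k` be as in
`response_at_slotStart`.  Then for every slot `k < 2(J+1)`, every `t` in it, every `x` and `i`:
`‖∂ᵢ L(t)(x)‖ ≤ Σ_{l<k} G^{k/2+1−l/2} (G₁ l + (N_{l/2}/δ_{l/2}) G₀ l) + 24π√(2π) ν N_{k/2}² γ / δ_{k/2}²`. -/
theorem response_phase_lip_envelope (hδ₀ : 0 < P.δ₀) (hd : 0 < P.d) (hγ : 0 ≤ P.γ) (hN : ∀ j, P.N j ≠ 0)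
    (hν : 0 < ν) {G : ℝ}
    (hLipν : ∀ (j₀ J : ℕ), j₀ ≤ J → ∀ (hz : Bool)
      (w₀ : UnitAddTorus (Fin 2) → EuclideanSpace ℝ (Fin 2))
      (w : ℝ → UnitAddTorus (Fin 2) → EuclideanSpace ℝ (Fin 2)) (q : ℝ → UnitAddTorus (Fin 2) → ℝ),
      ShearCombDatum (P.N j₀) hz w₀ →
      Torus.IsSmoothSpaceTimeOn (Icc (CascadeParams.tInject j₀ hz) (CascadeParams.tStart (J + 1))) w →
      Torus.IsSmoothSpaceTimeOn (Icc (CascadeParams.tInject j₀ hz) (CascadeParams.tStart (J + 1))) q →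
      (∀ t ∈ Icc (CascadeParams.tInject j₀ hz) (CascadeParams.tStart (J + 1)), Torus.IsDivFree (w t)) →
      (∀ t ∈ Icc (CascadeParams.tInject j₀ hz) (CascadeParams.tStart (J + 1)), ∀ x,
        Torus.timeDerivWithin (Icc (CascadeParams.tInject j₀ hz) (CascadeParams.tStart (J + 1))) w t x +
          Torus.convect (P.field t) (w t) x + Torus.convect (w t) (P.field t) x =
          ν • Torus.laplacian (w t) x - Torus.gradient (q t) x) →
      w (CascadeParams.tInject j₀ hz) = w₀ →
      ∀ (D₀ D₁ : ℝ), (∀ x, ‖w₀ x‖ ≤ D₀) → (∀ x, ‖Torus.fderiv w₀ x‖ ≤ D₁) →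
      ∀ t ∈ Icc (max (CascadeParams.tInject j₀ hz) (CascadeParams.tStart J)) (CascadeParams.tStart (J + 1)), ∀ x,
        ‖Torus.fderiv (w t) x‖ ≤ G ^ (J + 1 - j₀) * (D₁ + (P.N j₀ : ℝ) / P.δ j₀ * D₀))
    {J : ℕ} (hJT : tStart (J + 1) ≤ T')
    {L : ℝ → UnitAddTorus (Fin 2) → EuclideanSpace ℝ (Fin 2)} {q : ℝ → UnitAddTorus (Fin 2) → ℝ}
    (hL : Torus.IsSmoothSpaceTimeOn (Icc 0 T') L) (hq : Torus.IsSmoothSpaceTimeOn (Icc 0 T') q)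
    (hLdiv : ∀ t ∈ Icc 0 T', Torus.IsDivFree (L t)) (hL0 : L 0 = fun _ => 0)
    (hlin : ∀ t ∈ Icc 0 T', ∀ x, Torus.timeDerivWithin (Icc 0 T') L t x + Torus.convect (P.field t) (L t) x +
      Torus.convect (L t) (P.field t) x =
        ν • Torus.laplacian (L t) x - Torus.gradient (q t) x + ν • Torus.laplacian (P.field t) x)
    (hg : ∀ k < 2 * (J + 1), ContDiff ℝ ∞ (g k) ∧ Function.Periodic (g k) 1)
    (hcomb : ∀ k < 2 * (J + 1), ∀ m : ℤ, (¬ ∃ n : ℤ, m = (2 * n + 1) * (P.N (k / 2) : ℤ)) →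
      fourierCoeff (AddCircle.liftIco 1 0 fun y => (g k y : ℂ)) m = 0)
    (hG₀ : ∀ k < 2 * (J + 1), ∀ y, |g k y| ≤ G₀ k) (hG₁ : ∀ k < 2 * (J + 1), ∀ y, |deriv (g k) y| ≤ G₁ k)
    (hrealH : ∀ j, 2 * j < 2 * (J + 1) → ∀ c F : ℝ → ℝ → ℝ,
        ContDiffOn ℝ ∞ (Function.uncurry c) (Icc (tStart j) (tStart j + tHalf j) ×ˢ univ) →
        (∀ t ∈ Icc (tStart j) (tStart j + tHalf j), Function.Periodic (c t) 1) →
        (∀ t ∈ Icc (tStart j) (tStart j + tHalf j), ∀ y,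
          derivWithin (fun s => c s y) (Icc (tStart j) (tStart j + tHalf j)) t = ν * deriv (deriv (c t)) y) →
        c (tStart j) = g (2 * j) →
        ContDiffOn ℝ ∞ (Function.uncurry F) (Icc (tStart j) (tStart j + tHalf j) ×ˢ univ) →
        (∀ t ∈ Icc (tStart j) (tStart j + tHalf j), Function.Periodic (F t) 1) → F (tStart j) = (fun _ => 0) →
        (∀ t ∈ Icc (tStart j) (tStart j + tHalf j), ∀ y,
          derivWithin (fun s => F s y) (Icc (tStart j) (tStart j + tHalf j)) t =
            ν * deriv (deriv (F t)) y + ν * (P.rateH j t * deriv (deriv (P.U j)) y)) →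
        c (tStart j + tHalf j) = F (tStart j + tHalf j))
    (hrealV : ∀ j, 2 * j + 1 < 2 * (J + 1) → ∀ c F : ℝ → ℝ → ℝ,
        ContDiffOn ℝ ∞ (Function.uncurry c) (Icc (tStart j + tHalf j) (tStart (j + 1)) ×ˢ univ) →
        (∀ t ∈ Icc (tStart j + tHalf j) (tStart (j + 1)), Function.Periodic (c t) 1) →
        (∀ t ∈ Icc (tStart j + tHalf j) (tStart (j + 1)), ∀ y,
          derivWithin (fun s => c s y) (Icc (tStart j + tHalf j) (tStart (j + 1))) t = ν * deriv (deriv (c t)) y) →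
        c (tStart j + tHalf j) = g (2 * j + 1) →
        ContDiffOn ℝ ∞ (Function.uncurry F) (Icc (tStart j + tHalf j) (tStart (j + 1)) ×ˢ univ) →
        (∀ t ∈ Icc (tStart j + tHalf j) (tStart (j + 1)), Function.Periodic (F t) 1) →
        F (tStart j + tHalf j) = (fun _ => 0) →
        (∀ t ∈ Icc (tStart j + tHalf j) (tStart (j + 1)), ∀ y,
          derivWithin (fun s => F s y) (Icc (tStart j + tHalf j) (tStart (j + 1))) t =
            ν * deriv (deriv (F t)) y + ν * (P.rateV j t * deriv (deriv (P.U j)) y)) →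
        c (tStart (j + 1)) = F (tStart (j + 1)))
    {R : ℕ → ℝ → UnitAddTorus (Fin 2) → ℝ}
    (hW : ∀ i < 2 * (J + 1), Torus.IsSmoothSpaceTimeOn (Icc (CascadeParams.tInject (i / 2) (i % 2 == 0)) T') (W i))
    (hR : ∀ i < 2 * (J + 1), Torus.IsSmoothSpaceTimeOn (Icc (CascadeParams.tInject (i / 2) (i % 2 == 0)) T') (R i))
    (hWdiv : ∀ i < 2 * (J + 1), ∀ t ∈ Icc (CascadeParams.tInject (i / 2) (i % 2 == 0)) T', Torus.IsDivFree (W i t))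
    (hWlin : ∀ i < 2 * (J + 1), ∀ t ∈ Icc (CascadeParams.tInject (i / 2) (i % 2 == 0)) T', ∀ x,
      Torus.timeDerivWithin (Icc (CascadeParams.tInject (i / 2) (i % 2 == 0)) T') (W i) t x +
        Torus.convect (P.field t) (W i t) x + Torus.convect (W i t) (P.field t) x =
          ν • Torus.laplacian (W i t) x - Torus.gradient (R i t) x)
    (hW0H : ∀ j, 2 * j < 2 * (J + 1) → W (2 * j) (tStart j) =
      fun x => g (2 * j) (Torus.repr x 1) • EuclideanSpace.single (0 : Fin 2) (1 : ℝ))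
    (hW0V : ∀ j, 2 * j + 1 < 2 * (J + 1) → W (2 * j + 1) (tStart j + tHalf j) =
      fun x => g (2 * j + 1) (Torus.repr x 0) • EuclideanSpace.single (1 : Fin 2) (1 : ℝ))
    {k : ℕ} (hk : k < 2 * (J + 1)) {t : ℝ}
    (ht : t ∈ Icc (CascadeParams.tInject (k / 2) (k % 2 == 0)) (CascadeParams.tInject ((k + 1) / 2) ((k + 1) % 2 == 0)))
    (x : UnitAddTorus (Fin 2)) (i : Fin 2) :
    ‖Torus.partialDeriv i (L t) x‖ ≤
      ∑ l ∈ Finset.range k, G ^ (k / 2 + 1 - l / 2) * (G₁ l + (P.N (l / 2) : ℝ) / P.δ (l / 2) * G₀ l) +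
        24 * Real.pi * Real.sqrt (2 * Real.pi) * ν * ((P.N (k / 2) : ℕ) : ℝ) ^ 2 * P.γ / P.δ (k / 2) ^ 2 := by
  have hK : CascadeParams.tInject (2 * (J + 1) / 2) (2 * (J + 1) % 2 == 0) ≤ T' := by
    rw [slotStart_even (J + 1)]; exact hJT
  have hslot := response_slot_lip_bound P hδ₀ hd hγ hN hν hK hL hq hLdiv hL0 hlin hg hrealH hrealV hW hR hWdiv hWlin
    hW0H hW0V hk ht x i
  refine hslot.trans (add_le_add (Finset.sum_le_sum fun l hl => ?_) le_rfl)
  have hl' : l < k := Finset.mem_range.1 hl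
  have hlK : l < 2 * (J + 1) := hl'.trans hk
  obtain ⟨hdat, hs0, hs1⟩ := piece_lip_datum P hg hcomb hG₀ hG₁ hW0H hW0V hlK
  -- phase of slot `k`
  have hkJ : k / 2 ≤ J := by omega
  have hJ'T : tStart (k / 2 + 1) ≤ T' := (tStart_strictMono.monotone (Nat.succ_le_succ hkJ)).trans hJT
  have hlj : l / 2 ≤ k / 2 := Nat.div_le_div_right hl'.le
  have htK2 : t ∈ Icc (max (CascadeParams.tInject (l / 2) (l % 2 == 0)) (tStart (k / 2))) (tStart (k / 2 + 1)) := by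
    refine ⟨max_le ((slotStart_mono hl'.le).trans ht.1) ((tStart_half_le_slotStart k).trans ht.1), ?_⟩
    exact ht.2.trans (slotStart_succ_le_tStart k)
  exact piece_lip_bound P hLipν hdat hs0 hs1 (hW l hlK) (hR l hlK) (hWdiv l hlK) (hWlin l hlK) rfl hlj hJ'T htK2 x

end Envelope

end Summit.AnomalousDissipation.AnomalousDissipation.Theorems.SawtoothPulseCascade.ApproxResponse

end
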